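import Mathlib

/-!
# Stub S6 `stub_cubicArithmetic` for crux stmt-ValiantsHypothesis-6625, line Sketch

The closing arithmetic of the line: there are `n(n-1)/2` pairs `a < b` in `Fin n`, so the per-block
bounds `card {a < b} ≤ 9(ℓ_k + 1)` summed over the `n` blocks with `Σ_k ℓ_k ≤ L` give
`n³/36 ≤ L` for `n ≥ 8`.
-/

-- `Summit.ValiantsHypothesis.ValiantsHypothesis.…` is the tree's mandated single-conjunct layout.
set_option linter.dupNamespace false

namespace Summit.ValiantsHypothesis.ValiantsHypothesis.Theorems.ElementaryWordLengthWordPerCubic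

/-- The number of ordered pairs `a < b` in `Fin n` is the Gauss sum `0 + 1 + ⋯ + (n - 1)`.
[folklore] -/
theorem card_pairs_lt_eq_sum_range (n : ℕ) :
    Fintype.card {e : Fin n × Fin n // e.1 < e.2} = ∑ i ∈ Finset.range n, i := by
  rw [Fintype.card_subtype, Finset.card_filter, Fintype.sum_prod_type]
  have h : ∀ a : Fin n, (∑ b : Fin n, if a < b then 1 else 0) = n - 1 - (a : ℕ) := by
    intro a
    rw [← Finset.card_filter, Finset.filter_lt_eq_Ioi, Fin.card_Ioi]
  simp_rw [h]
  rw [Fin.sum_univ_eq_sum_range (fun i => n - 1 - i) n, Finset.sum_range_reflect (fun i => i) n]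

/-- Twice the number of ordered pairs `a < b` in `Fin n` is `n(n-1)`. [folklore] -/
theorem card_pairs_lt_mul_two (n : ℕ) :
    Fintype.card {e : Fin n × Fin n // e.1 < e.2} * 2 = n * (n - 1) := by
  rw [card_pairs_lt_eq_sum_range, Finset.sum_range_id_mul_two]

/-- S6 — **arithmetic**: `card {a < b} = n(n-1)/2 ≤ 9(ℓ_k + 1)` for all `k` and `Σ_k ℓ_k ≤ L` give
`n³/36 ≤ L` once `n ≥ 8`. -/
theorem stub_cubicArithmetic (n : ℕ) (hn : 8 ≤ n) (L : ℕ) (ℓ : Fin n → ℕ)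
    (hℓ : ∀ k, Fintype.card {e : Fin n × Fin n // e.1 < e.2} ≤ 9 * (ℓ k + 1))
    (hsum : ∑ k, ℓ k ≤ L) : (1 / 36 : ℝ) * (n : ℝ) ^ 3 ≤ (L : ℝ) := by
  -- per block: `n(n-1) ≤ 18(ℓ_k + 1)`
  have hk : ∀ k, n * (n - 1) ≤ 9 * (ℓ k + 1) * 2 := fun k =>
    (card_pairs_lt_mul_two n).symm.le.trans (Nat.mul_le_mul_right 2 (hℓ k))
  -- summed over the `n` blocks: `n · n(n-1) ≤ 18 Σ ℓ_k + 18 n`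
  have hs : n * (n * (n - 1)) ≤ (9 * ∑ k, ℓ k + 9 * n) * 2 :=
    calc n * (n * (n - 1)) = ∑ _k : Fin n, n * (n - 1) := by simp
      _ ≤ ∑ k, 9 * (ℓ k + 1) * 2 := Finset.sum_le_sum fun k _ => hk k
      _ = (9 * ∑ k, ℓ k + 9 * n) * 2 := by
        rw [← Finset.sum_mul, ← Finset.mul_sum, Finset.sum_add_distrib]
        simp [mul_add]
  have h1 : (1 : ℕ) ≤ n := le_trans (by norm_num) hn
  have hR : (n : ℝ) * ((n : ℝ) * ((n : ℝ) - 1)) ≤ (9 * (L : ℝ) + 9 * (n : ℝ)) * 2 := by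
    have hc : ((n * (n * (n - 1)) : ℕ) : ℝ) ≤ (((9 * ∑ k, ℓ k + 9 * n) * 2 : ℕ) : ℝ) := by
      exact_mod_cast hs
    have hsumR : (∑ k, (ℓ k : ℝ)) ≤ (L : ℝ) := by exact_mod_cast hsum
    push_cast [Nat.cast_sub h1] at hc
    linarith [hc, hsumR]
  have hn' : (8 : ℝ) ≤ (n : ℝ) := by exact_mod_cast hn
  have hcube : (0 : ℝ) ≤ (n : ℝ) * ((n : ℝ) - 8) * ((n : ℝ) + 6) := by
    have : (0 : ℝ) ≤ (n : ℝ) - 8 := by linarith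
    positivity
  nlinarith [hR, hcube, hn']

end Summit.ValiantsHypothesis.ValiantsHypothesis.Theorems.ElementaryWordLengthWordPerCubic
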